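import Summits.AnomalousDissipation.AnomalousDissipation.Theorems.SawtoothPulseCascadeK1LocalisedCascadeOscFatSegmentSharp
import Summits.AnomalousDissipation.AnomalousDissipation.Theorems.SawtoothPulseCascadeK1LocalisedCascadeOscJunction11
import Summits.AnomalousDissipation.AnomalousDissipation.Theorems.SawtoothPulseCascadeK1LocalisedCascadeTailCorollary

/-!
# K1loc′ FROM THE PHASE-5 INPUTS, SHARP FORM: `E₅ + 0.0686·o₅ ≤ 0.480 ⇒ K1Localised` (a second entry point of the landed tail)

Prover lane on the crux `K1LocalisedCascade` (stmt-AnomalousDissipation-19491), route `SawtoothPulseCascade` (S-B/S-C assembly seat;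
arbiter A24-14: closer B = a corner-trace certificate of phases 2–3(–4) with its own keying, joining the LANDED tail).  `…TailFinalSharp`
enters the tail at phase 4 (`a₄`-threshold `500000`); this file enters ONE PHASE LATER, at the `a₅`-threshold `K₅ = 12 500 000` of the
schedule of record (`K_j = 800·25^{j−2}`), so that any certificate of phases `≤ 4` that exits at `(K₅, cone (1,4))` closes K1loc′:
chaining `resolved_step_osc_phase5_sharp … phase10_sharp` (`E₁₁ ≤ E₅ + (0.0105 + 0.0686·o₅) + 0.0025`, `o₁₁ ≤ 0.0014`),
`…OscJunction11.junction_step_phase11` (`+ 0.0032 + 0.0002·0.0014`, `o₁₂ ≤ 0.0558`) and `…TailClose.k1Localised_of_phase12`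
(`B + 0.0033 < ‖datum‖² = ½`):
  **`k1Localised_of_phase5_sharp`**: `S₅(12500000) + O₅(12500000) ≤ E₅`, `√O₅(12500000) ≤ o₅`, `E₅ + 0.0686·o₅ ≤ 0.480` ⇒
  `K1Localised P (γ² − 3)` (`γ = 8`, `0 < δ₀ ≤ 2⁻¹⁰⁰`, `(d, N₀, ρ_N) = (2, 1, 2)`);
  **`k1Localised_of_phase5_start_sharp`**: the same with the phase-5 hypotheses quantified over all admissible iterate pairs.
Budget check: `0.480 + 0.0105 + 0.0025 + 0.0033 + 0.0033 = 0.4996 < ½`.  An Osc-grade entry BELOW `K₄ = 5·10⁵` is not offered: the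
phase-4 window junk scales like `1/K` (`e₄(1.2·10⁵) ≈ 0.48 + 0.25·o₄`).
No definitions; no statement about the crux itself. [cite: DEIJ2022, (1.2)–(1.3)] [cite: Grafakos2014, Prop. 3.2.7 (3)] [problem: turb]
-/

-- `Summit.<Summit>.<Problem>`: single-conjunct summit, the duplicate namespace segment is deliberate.
set_option linter.dupNamespace false

noncomputable section

namespace Summit.AnomalousDissipation.AnomalousDissipation.Theorems.SawtoothPulseCascade.K1Window

open MeasureTheory Set Filter Topology UnitAddTorus Function Complex Metric
open scoped Real ENNReal
open Literature.Analysis Literature.Analysis.FunctionSpaces Literature.Analysis.FunctionSpaces.Torus Literature.Analysis.FluidPDE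
open Literature.Analysis.FluidPDE.ShearStage
open Literature.Analysis.FluidPDE.SawtoothCascade Literature.Analysis.FluidPDE.SawtoothCascade.CascadeParams
open Summit.AnomalousDissipation.AnomalousDissipation.Theorems.SawtoothPulseCascade.K1Start
open Summit.AnomalousDissipation.AnomalousDissipation.Theorems.SawtoothPulseCascade.K1Flat
open Summit.AnomalousDissipation.AnomalousDissipation.Theorems.SawtoothPulseCascade.K1Ledger.From

section Cascade

variable (P : CascadeParams)

/-- **THE FAT SEGMENT FROM PHASE 5, SHARP**: `E₁₁ ≤ E₅ + (0.0130 + 0.0686·o₅)` and `o₁₁ ≤ 0.0014`, chaining the landed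
`resolved_step_osc_phase5_sharp … phase10_sharp`. [cite: Grafakos2014, Prop. 3.2.7 (3)] -/
theorem fat_segment_osc_sharp_from5_le_11 (hγ : P.γ = 8) (hδ₀ : 0 < P.δ₀) (hδ₀' : P.δ₀ ≤ (2 : ℝ)⁻¹ ^ 100) (hd : P.d = 2)
    (hN₀ : P.N₀ = 1) (hρN : P.ρN = 2) (a b : ℕ → UnitAddTorus (Fin 2) → ℝ) (has : ∀ j, IsSmooth (a j)) (h0 : a 0 = datum)
    (hb : ∀ j, b j = a j ∘ shearMap 0 1 (amp ⟨P.U j, P.U_periodic j, P.contDiff_U (P.δ_pos hδ₀ (by rw [hd]; norm_num) j)⟩ P.γ))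
    (hab : ∀ j, a (j + 1) = b j ∘ shearMap 1 0 (amp ⟨P.U j, P.U_periodic j, P.contDiff_U (P.δ_pos hδ₀ (by rw [hd]; norm_num) j)⟩ P.γ))
    {o : ℝ} (ho0 : 0 ≤ o)
    (ho : Real.sqrt (∑' k : Fin 2 → ℤ, (if ((12500000 : ℕ) : ℤ) ≤ |k 0| ∧ ((1 : ℕ) : ℤ) * |k 0| ≤ ((4 : ℕ) : ℤ) * |k 1| then (1 : ℝ) else 0) *
          ‖mFourierCoeff (fun x => (a 5 x : ℂ)) k‖ ^ 2) ≤ o) :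
    ∑' k : Fin 2 → ℤ, (if |k 0| < ((3051757812500000 : ℕ) : ℤ) then (1 : ℝ) else 0) * ‖mFourierCoeff (fun x => (a 11 x : ℂ)) k‖ ^ 2 +
        ∑' k : Fin 2 → ℤ, (if ((3051757812500000 : ℕ) : ℤ) ≤ |k 0| ∧ ((1 : ℕ) : ℤ) * |k 0| ≤ ((4 : ℕ) : ℤ) * |k 1| then (1 : ℝ) else 0) *
          ‖mFourierCoeff (fun x => (a 11 x : ℂ)) k‖ ^ 2 ≤
      ∑' k : Fin 2 → ℤ, (if |k 0| < ((12500000 : ℕ) : ℤ) then (1 : ℝ) else 0) * ‖mFourierCoeff (fun x => (a 5 x : ℂ)) k‖ ^ 2 +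
        ∑' k : Fin 2 → ℤ, (if ((12500000 : ℕ) : ℤ) ≤ |k 0| ∧ ((1 : ℕ) : ℤ) * |k 0| ≤ ((4 : ℕ) : ℤ) * |k 1| then (1 : ℝ) else 0) *
          ‖mFourierCoeff (fun x => (a 5 x : ℂ)) k‖ ^ 2 + (0.0130 + 0.0686 * o) ∧
    Real.sqrt (∑' k : Fin 2 → ℤ, (if ((3051757812500000 : ℕ) : ℤ) ≤ |k 0| ∧ ((1 : ℕ) : ℤ) * |k 0| ≤ ((4 : ℕ) : ℤ) * |k 1| then (1 : ℝ) else 0) *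
          ‖mFourierCoeff (fun x => (a 11 x : ℂ)) k‖ ^ 2) ≤ 0.0014 := by
  obtain ⟨h5, o6⟩ := resolved_step_osc_phase5_sharp P hγ hδ₀ hδ₀' hd hN₀ hρN a b has h0 hb hab ho0 ho
  obtain ⟨h6, o7⟩ := resolved_step_osc_phase6_sharp P hγ hδ₀ hδ₀' hd hN₀ hρN a b has h0 hb hab (by norm_num) o6
  obtain ⟨h7, o8⟩ := resolved_step_osc_phase7_sharp P hγ hδ₀ hδ₀' hd hN₀ hρN a b has h0 hb hab (by norm_num) o7
  obtain ⟨h8, o9⟩ := resolved_step_osc_phase8_sharp P hγ hδ₀ hδ₀' hd hN₀ hρN a b has h0 hb hab (by norm_num) o8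
  obtain ⟨h9, o10⟩ := resolved_step_osc_phase9_sharp P hγ hδ₀ hδ₀' hd hN₀ hρN a b has h0 hb hab (by norm_num) o9
  obtain ⟨h10, o11⟩ := resolved_step_osc_phase10_sharp P hγ hδ₀ hδ₀' hd hN₀ hρN a b has h0 hb hab (by norm_num) o10
  have hnum : (0.000934 : ℝ) + 0.0194 * 0.0635 + (0.000092 + 0.0056 * 0.0193) +
      (0.000013 + 0.0016 * 0.0062) + (0.000005 + 0.0006 * 0.0024) + (0.000004 + 0.0002 * 0.0015) ≤ 0.0025 := by norm_num
  exact ⟨by linarith [h5, h6, h7, h8, h9, h10], o11⟩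

/-- **K1loc′ FROM THE PHASE-5 INPUTS, SHARP** (see the file header): `S₅ + O₅ ≤ E₅` at the `a₅`-threshold `12500000`, `√O₅ ≤ o₅`,
`E₅ + 0.0686·o₅ ≤ 0.480` give `K1Localised P (γ² − 3)` for `γ = 8`, `0 < δ₀ ≤ 2⁻¹⁰⁰`. [cite: DEIJ2022, (1.2)–(1.3)] [cite: Grafakos2014, Prop. 3.2.7 (3)] -/
theorem k1Localised_of_phase5_sharp (hγ : P.γ = 8) (hδ₀ : 0 < P.δ₀) (hδ₀' : P.δ₀ ≤ (2 : ℝ)⁻¹ ^ 100) (hd : P.d = 2) (hN₀ : P.N₀ = 1)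
    (hρN : P.ρN = 2) (a b : ℕ → UnitAddTorus (Fin 2) → ℝ) (has : ∀ j, IsSmooth (a j)) (h0 : a 0 = datum)
    (hb : ∀ j, b j = a j ∘ shearMap 0 1 (amp ⟨P.U j, P.U_periodic j, P.contDiff_U (P.δ_pos hδ₀ (by rw [hd]; norm_num) j)⟩ P.γ))
    (hab : ∀ j, a (j + 1) = b j ∘ shearMap 1 0 (amp ⟨P.U j, P.U_periodic j, P.contDiff_U (P.δ_pos hδ₀ (by rw [hd]; norm_num) j)⟩ P.γ))
    {E₅ o₅ : ℝ} (ho₅ : 0 ≤ o₅)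
    (hE₅ : ∑' k : Fin 2 → ℤ, (if |k 0| < ((12500000 : ℕ) : ℤ) then (1 : ℝ) else 0) * ‖mFourierCoeff (fun x => (a 5 x : ℂ)) k‖ ^ 2 +
        ∑' k : Fin 2 → ℤ, (if ((12500000 : ℕ) : ℤ) ≤ |k 0| ∧ ((1 : ℕ) : ℤ) * |k 0| ≤ ((4 : ℕ) : ℤ) * |k 1| then (1 : ℝ) else 0) *
          ‖mFourierCoeff (fun x => (a 5 x : ℂ)) k‖ ^ 2 ≤ E₅)
    (ho : Real.sqrt (∑' k : Fin 2 → ℤ, (if ((12500000 : ℕ) : ℤ) ≤ |k 0| ∧ ((1 : ℕ) : ℤ) * |k 0| ≤ ((4 : ℕ) : ℤ) * |k 1| then (1 : ℝ) else 0) *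
          ‖mFourierCoeff (fun x => (a 5 x : ℂ)) k‖ ^ 2) ≤ o₅)
    (hbudget : E₅ + 0.0686 * o₅ ≤ 0.480) :
    K1Localised P (P.γ ^ 2 - 3) := by
  obtain ⟨h11, o11⟩ := fat_segment_osc_sharp_from5_le_11 P hγ hδ₀ hδ₀' hd hN₀ hρN a b has h0 hb hab ho₅ ho
  obtain ⟨h12, o12⟩ := junction_step_phase11 P hγ hδ₀ hδ₀' hd hN₀ hρN a b has h0 hb hab (o := 0.0014) (by norm_num) o11
  refine k1Localised_of_phase12 P hγ hδ₀ hδ₀' hd hN₀ hρN a b has h0 hb hab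
    (B := E₅ + (0.0130 + 0.0686 * o₅) + (0.0032 + 0.0002 * 0.0014))
    (h12.trans (add_le_add (h11.trans (add_le_add hE₅ (le_refl _))) (le_refl _))) o12 ?_
  rw [scalarL2Sq_datum]
  norm_num
  linarith [hbudget]

/-- **K1loc′ MODULO THE PHASE-5 START, SHARP**: the hypotheses of `k1Localised_of_phase5_sharp` quantified over all admissible iterate
pairs (`…TailCorollary.exists_iterates` supplies one). [cite: DEIJ2022, (1.2)–(1.3)] -/
theorem k1Localised_of_phase5_start_sharp (hγ : P.γ = 8) (hδ₀ : 0 < P.δ₀) (hδ₀' : P.δ₀ ≤ (2 : ℝ)⁻¹ ^ 100) (hd : P.d = 2)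
    (hN₀ : P.N₀ = 1) (hρN : P.ρN = 2)
    (hstart : ∀ a b : ℕ → UnitAddTorus (Fin 2) → ℝ, (∀ j, IsSmooth (a j)) → a 0 = datum →
      (∀ j, b j = a j ∘ shearMap 0 1 (amp ⟨P.U j, P.U_periodic j, P.contDiff_U (P.δ_pos hδ₀ (by rw [hd]; norm_num) j)⟩ P.γ)) →
      (∀ j, a (j + 1) = b j ∘ shearMap 1 0 (amp ⟨P.U j, P.U_periodic j, P.contDiff_U (P.δ_pos hδ₀ (by rw [hd]; norm_num) j)⟩ P.γ)) →
      ∃ E₅ o₅ : ℝ, 0 ≤ o₅ ∧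
        ∑' k : Fin 2 → ℤ, (if |k 0| < ((12500000 : ℕ) : ℤ) then (1 : ℝ) else 0) * ‖mFourierCoeff (fun x => (a 5 x : ℂ)) k‖ ^ 2 +
          ∑' k : Fin 2 → ℤ, (if ((12500000 : ℕ) : ℤ) ≤ |k 0| ∧ ((1 : ℕ) : ℤ) * |k 0| ≤ ((4 : ℕ) : ℤ) * |k 1| then (1 : ℝ) else 0) *
            ‖mFourierCoeff (fun x => (a 5 x : ℂ)) k‖ ^ 2 ≤ E₅ ∧
        Real.sqrt (∑' k : Fin 2 → ℤ, (if ((12500000 : ℕ) : ℤ) ≤ |k 0| ∧ ((1 : ℕ) : ℤ) * |k 0| ≤ ((4 : ℕ) : ℤ) * |k 1| then (1 : ℝ) else 0) *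
            ‖mFourierCoeff (fun x => (a 5 x : ℂ)) k‖ ^ 2) ≤ o₅ ∧
        E₅ + 0.0686 * o₅ ≤ 0.480) :
    K1Localised P (P.γ ^ 2 - 3) := by
  obtain ⟨a, b, has, h0, hb, hab⟩ := exists_iterates P hδ₀ (by rw [hd]; norm_num)
  obtain ⟨E₅, o₅, ho₅, hE, ho, hbud⟩ := hstart a b has h0 hb hab
  exact k1Localised_of_phase5_sharp P hγ hδ₀ hδ₀' hd hN₀ hρN a b has h0 hb hab ho₅ hE ho hbud

end Cascade

end Summit.AnomalousDissipation.AnomalousDissipation.Theorems.SawtoothPulseCascade.K1Window
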